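import Summits.BirchSwinnertonDyer.Rank1Residual.X12.O11.RouteUEvenMember
import Summits.BirchSwinnertonDyer.Rank1Residual.X11b.AnticyclotomicEmbedding
import Summits.BirchSwinnertonDyer.Rank1Residual.X11b.RouteR1LogOmega
import Literature.NumberTheory.EllipticCurves.BSDHeegnerPointsModularityOnlyProofs
import Literature.NumberTheory.EllipticCurves.LeadingTermProofs
import Literature.NumberTheory.EllipticCurves.AnalyticRankModularityProofs
import Literature.NumberTheory.EllipticCurves.BSDRootNumberOddParityProofs
import Literature.NumberTheory.EllipticCurves.ComplexMultiplicationLFunctionIsogenyHoldsProofs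
import Literature.NumberTheory.EllipticCurves.ComplexMultiplicationLFunctionTableProofs
import Literature.NumberTheory.EllipticCurves.IsogenyVariableChangeProofs
import Literature.NumberTheory.EllipticCurves.LFunctionSmulProofs
import Literature.NumberTheory.EllipticCurves.GlobalMinimalModelProofs
import Literature.NumberTheory.QuadraticFields.FundamentalDiscriminant
import Literature.NumberTheory.QuadraticFields.ImaginaryQuadraticPrescribedSplitting
import Mathlib.Tactic.NormNum.LegendreSymbol
import HarnessLib

set_option linter.dupNamespace false -- namespace `…BirchSwinnertonDyer.BirchSwinnertonDyer…` is the cell's (D-0017 nested layout)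
set_option autoImplicit false

/-!
# K12₂″, the 7-INERT half — FIRST RUNG: Kriz–Li 2019 Thm. 1.20 at `p = 7` applied to the TWIST
# `W = 49a1^{(−4n)}` ITSELF over an auxiliary Heegner field `ℚ(√−r)` puts the twist's own Heegner point
# off the torsion, on BOTH halves of the additive cell (no Heegner point of `X₀(49)` over `ℚ(√−n)` needed)

Cell `bsd-goldfeld`, seat `bsd-goldfeld-s1p-c201` (prover, gen 8), TARGET v5.5 §2 c201 g8 ORDER (2) «INERT-HALF
FIRST-RUNG DECISION» (planner g16 rulings (xxxiii)–(xxxv)). `--supports` item stmt-BirchSwinnertonDyer-20044 (K12₂″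
`…Theses.GoldfeldAllTwistsTwoConverse.RankOneTwoConverseCMSevenAdditiveTwo`, RANK axis; registered skeleton v7
«sevens-halves», stub `stub_inertHalfGenusNonTorsion : X049GenusPointNonTorsionInertSeven`). THESES-FREE module
(hygiene (xxxi)(a)): it imports no `Theses` file and no module of the cell's Theses cone — only bsd-cm's ROUTE U
(`Rank1Residual/X12/O11`), the `X11b` embedding/logarithm bridge and `Literature`. HONEST FRAMING: `p = 7`, RANK
axis; nothing here is about `p = 2`; K12₂″ and both research stubs stay OPEN; the families below are WITNESS families
(density zero); BSD is not proved by any of this; a closed item would close a rung leaf only.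

## The point (memo `INERT-RUNG-DECISION.md`)
The cell's rank-one theorems on the additive cell (LINE B49: Birch half-trace, genus descent, Kriz–Li at `7`
p471659–p477112) all live on the HEEGNER half `(−n/7) = +1` of the negative twists `49a1^{(−n)}`: they use the
level-`49` Heegner point of `X₀(49)` over `ℚ(√−n)`, which exists only when `7` splits there (c301 g5: "NOT covered: the
non-Heegner half … KL19 needs the Heegner hypothesis"). The planner's candidate first rung for the INERT half — a
genus-parity proof of `P_{χ₅} ∉ tors` on the `4`-rank-`0` class of `Cl(ℚ(√−5ℓ))` — is FALSE as posed (Rédei: the class is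
`ℓ ≡ 1 (8)`, `(ℓ/5) = −1`, and contains the rank-`3` primes `2657, 4673, 5737` of census j264668; memo §1–§2).
The road taken here needs NO Heegner point over `ℚ(√−n)`: apply Kriz–Li Thm. 1.20 to the twist `W ≅ 49a1^{(−4n)}`
itself (conductor `784n²`/`3136(n/2)²`, CM, `W[7]^{ss} ≅ 𝔽₇(χ_{−4n}ω²) ⊕ 𝔽₇(χ_{−4n}ω⁵)`) over an AUXILIARY
imaginary quadratic field `K = ℚ(√−r)`, `r ≡ 7 (mod 8)` prime, in which `2`, `7` and every prime of `n` split
(Heegner hypothesis for `N(W)`). This is EXACTLY the frame of bsd-cm's ROUTE U even-member class theorem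
`RouteU.bsdp_seven_of_twist_cm7_even` (which draws `BSD₇(W)` from it and ASSUMES `r_an(W) = 1`); hypotheses (1)–(3) of
Thm. 1.20 hold because `7`, `2` and the primes of `n` divide the conductor `28n` of `ψ = χ_{−4n}ω²` (values `0`),
and the Bernoulli pair is `B_{1,ψ₀⁻¹ε_K}·B_{1,ψ₀ω⁻¹} = B_{1,ω⁴χ_{−4n}} · B_{1,ωχ_{−4n}χ_{−r}}` — the FIRST factor is
c301's Heegner-half certificate `S(n)` verbatim (now needed on the inert half too), the SECOND depends on `r` and
can be re-drawn by changing `r`. Conclusion: the Heegner point `P ∈ W(K)` of `W` has `log_{ω_W} P ≢ 0 (mod 7)`,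
hence infinite order (§1); by Gross–Zagier `ord_{s=1} L(W/K, s) = 1 = r_an(W) + r_an(W^{(−r)})`, so `r_an(W) ≤ 1`,
and `r_an(W)` is ODD — here from `corank₂(W) = 1` by `2`-parity (the crux's own hypothesis; the unconditional
sign-law version `w(49a1^{(−n)}) = −1` lives in the cone file `…TwinAdditiveSign` and is drawn in the sequel) —
so `r_an(W) = 1` (§2): «D(n)» / K12₂″'s conclusion OUTRIGHT for every such `W`, `(−n/7) = −1` INCLUDED. Members
(sequel file): `n = 1` (`784 = 49a1^{(−1)}`, `r = 31`) and `n = 2` (`3136⁻ = 49a1^{(−2)}`, `r = 47`) — both on the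
INERT half (`(−1/7) = (−2/7) = −1`) — from bsd-cm's landed certificates `RouteU.…theta1/2_E4/_E8`, no new computation;
they also hand bsd-cm's `RouteU.bsdp_seven_of_twist_cm7_E4/_E8` their binder `hr1` from `corank₂ = 1` (cross-cell).

## Contents (THEOREMS ONLY; no `def`, no instance, no named fact; every published input a cite-tagged binder BY NAME)

§0 `satisfiesHeegnerHypothesis_twist_cm7_even` (Heegner hypothesis for `(N(W), ℚ(√−r))`, `7` split); §1 **A**
`not_isOfFinAddOrder_heegnerPoint_twist_cm7_even_of_thm120` (KL19 ∧ cert₁(n) ∧ cert₂(n,r) ⟹ every level-`N(W)` Heegner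
point `P ∈ W(ℚ(√−r))` — any datum, any Manin constant — has infinite order, for every globally minimal
`W ≅ 49a1^{(−4n)}`); §2 **B** `analyticRankEK_twist_cm7_even_eq_one_of_thm120` (`ord L(W/K) = 1`, + Modularity `hnf`,
Gross–Zagier `hGZ`, Heegner rationality `hHP`), `analyticRank_add_twist_eq_one_…` (`r_an(W) + r_an(W^{(−r)}) = 1`),
`analyticRank_le_one_…`, **C** `…_of_odd` (`r_an` odd ⇒ `= 1`), `rankOneTwoConverse_twist_cm7_even_of_thm120` (K12₂″'s
implication OUTRIGHT on these `W`, oddness from `corank₂ = 1` by `p_parity` at `2`) and the model-free form for every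
elliptic `W′ ≅ 49a1^{(−n)}`. Members: the sequel `…InertSevenKrizLi7TwistMembers` (`n = 1, 2` from bsd-cm's `E4`/`E8`
certificates; further `n` by one certificate pair each).

PRESEARCH: [corpus:paper:doi-10-1017-fms-2019-9 §1.6, Rem. 1.21, §10] Kriz–Li apply Thm. 1.20 to twist families over a
FIXED `K`; the twist-over-auxiliary-`K` idiom for `X₀(49)` is bsd-cm's ROUTE U (BSD₇, `hr1` ASSUMED); the `r_an` corollary
is written nowhere we hold (c301 KL7: Heegner half only); [galaxy: "Kriz-Li|X_0(49)" star all → none]. No new mathematics.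
References: [KrizLi2019] Thm. 1.20 = Thm. 7.1, Rem. 1.17, Rem. 1.21, §1.5, §2; [GrossZagier1986] I.(6.3), I.§7, V.§2;
[DokchitserDokchitserAnnals2010] Thm. 1.4; [Washington1997] §5.1; [Cox2013] 1.14; [SilvermanAEC2009] IV.6.4, VII.6.3, VIII.8.3, X.5.4.
-/

noncomputable section

open scoped Classical NumberTheorySymbols

open NumberField WeierstrassCurve DirichletCharacter
open Literature.NumberTheory.EllipticCurves Literature.NumberTheory.EllipticCurves.Rank1Residual
open Literature.NumberTheory.EllipticCurves.KrizLi2019 Literature.NumberTheory.LFunctions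
open Literature.NumberTheory.EllipticCurves.ModularForms
open Literature.NumberTheory.QuadraticFields
open Summit.BirchSwinnertonDyer.Rank1Residual
open Summit.BirchSwinnertonDyer.Rank1Residual.X12.O11.RouteU

namespace Summit.BirchSwinnertonDyer.BirchSwinnertonDyer.Theorems.GoldfeldGoodTwists

/-! ## §0 The auxiliary Heegner field `K = ℚ(√−r)`: the Heegner hypothesis for `N(49a1^{(−4n)})` -/

/-- **Heegner hypothesis for `(N(W), ℚ(√−r))`, `W ≅ 49a1^{(−4n)}`**: the bad primes of `W` other than `7` are `2`
or divide `n` (`RouteU.eq_two_or_dvd_of_not_hasGoodReductionAtPrime_twist_cm7_even`); `7` splits in `K` by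
`(−r/7) = 1`, `2` by `r ≡ 7 (mod 8)`, an odd `q ∣ n` by `(−r/q) = 1`. Also returned: `7` splits (the `p`-split
hypothesis of Thm. 1.20). [cite: GrossLMS1991, §1 (p. 235)] [cite: Cox2013, §1.C Lemma 1.14 and (1.18)] -/
theorem satisfiesHeegnerHypothesis_twist_cm7_even {n r : ℕ}
    (hr8 : r % 8 = 7) (h7split : legendreSym 7 (-(r : ℤ)) = 1)
    (hsplit : ∀ q : ℕ, q.Prime → q ∣ n → q ≠ 2 → J(-(r : ℤ) | q) = 1)
    (W : WeierstrassCurve ℚ) [W.IsElliptic]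
    (hW : ∃ C : VariableChange ℚ, C • W = cm7.quadraticTwist ((-(4 * (n : ℤ)) : ℤ) : ℚ))
    (K : Type) [Field K] [NumberField K] (hK : IsImaginaryQuadratic K) (hdK : NumberField.discr K = -(r : ℤ)) :
    SatisfiesHeegnerHypothesis (W.conductorNorm ℤ) K ∧ ((Ideal.span {(7 : ℤ)}).primesOver (𝓞 K)).ncard = 2 := by
  haveI : Fact (Nat.Prime 7) := ⟨by norm_num⟩
  have h7K : ((Ideal.span {(7 : ℤ)}).primesOver (𝓞 K)).ncard = 2 := by
    have := ncard_primesOver_eq_two_of_legendreSym hK (ℓ := 7) (by norm_num) (by rw [hdK]; exact h7split)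
    exact_mod_cast this
  have h2K : ((Ideal.span {(2 : ℤ)}).primesOver (𝓞 K)).ncard = 2 :=
    ncard_primesOver_two_eq_two_of_mod_eight hK hdK hr8
  have hqK : ∀ q : ℕ, (hq : q.Prime) → q ∣ n → q ≠ 2 →
      ((Ideal.span {(q : ℤ)}).primesOver (𝓞 K)).ncard = 2 := fun q hq hqn hq2 => by
    haveI := Fact.mk hq
    exact ncard_primesOver_eq_two_of_legendreSym hK hq2
      (by rw [hdK, jacobiSym.legendreSym.to_jacobiSym]; exact hsplit q hq hqn hq2)
  refine ⟨fun p hp hpN => ?_, h7K⟩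
  by_cases hp7 : p = 7
  · subst hp7; exact_mod_cast h7K
  · haveI := Fact.mk hp
    rcases eq_two_or_dvd_of_not_hasGoodReductionAtPrime_twist_cm7_even W hW p hp7
        (fun hgood => not_dvd_conductorNorm_of_hasGoodReductionAtPrime W hgood hpN) with h | h
    · subst h; exact_mod_cast h2K
    · by_cases hp2 : p = 2
      · subst hp2; exact_mod_cast h2K
      · exact hqK p hp h hp2

/-! ## §1 A — the twist's own Heegner point over `ℚ(√−r)` has infinite order (KL19 Thm. 1.20 at `p = 7`) -/

/-- **A. Kriz–Li Thm. 1.20 for the TWIST `W ≅ 49a1^{(−4n)}` over `K = ℚ(√−r)`: every level-`N(W)` Heegner point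
`P ∈ W(K)` has infinite order**, for `n ≡ 1, 2 (mod 4)` squarefree, `7 ∤ n` (BOTH halves: no condition on
`(−n/7)`), `r ≡ 7 (mod 8)` prime, `r ≠ 7`, `(r, n) = 1`, `(−r/7) = 1`, `(−r/q) = 1` for odd primes `q ∣ n`, granted the
named fact `KrizLi2019.thm120_padicLogHeegner_unit_of_bernoulli` and the two Bernoulli-unit CERTIFICATES
`hcert₁ : ‖B_{1,ω⁴χ_{−4n}}‖₇ = 1` (level `7·4n`, bsd-cm / c301 shape) and `hcert₂ : ‖B_{1,ωχ_{−4n}χ_{−r}}‖₇ = 1`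
(level `7·4n·r`). Instantiation — literally bsd-cm's `RouteU.bsdp_seven_of_twist_cm7_even` up to the call of the
fact: `p = 7` (additive for `W`, allowed: FMS p. 42, Rem. 1.21), `ψ = χ_{−4n}·ω²` (primitive of conductor `28n`,
odd, so `ψ₀ = ψε_K`), trace form `a_ℓ(W) ≡ χ(ℓ)(ℓ² + ℓ⁵)` (`RouteU.hss_twist_cm7_even`), (1) `ψ(7) = 0 ≠ 1`,
`(ψ⁻¹ω)(7) ≠ 1`, (2) CM ⇒ no multiplicative prime, (3) every additive `ℓ ≠ 7` is `2` or divides `n`, so `ℓ ∣ 28n`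
and `ψ(ℓ) = 0`; `ε_K` = the Legendre character mod `r` lifted to `|d_K| = r`; Bernoulli pair
`B_{1,ψ⁻¹}·B_{1,ψε_Kω⁻¹}` read on the certificates (`RouteU.bernoulli_hypothesis_of_certs`); the embedding `K ↪ ℚ₇`
at a degree-one prime over `7` (`X11b.embAt`). Conclusion `(|W̃^{ns}(𝔽₇)|/7)·log_{ω_W} P ≢ 0 (mod 7)` ⇒
`log_{ω_𝓦} P ≠ 0` ⇒ `P ∉ W(K)_tors` (`X11b.R1.logOmega_eq_zero_iff`). [cite: KrizLi2019, Thm. 1.20 (pp. 7–8) = Thm. 7.1 (pp. 42–43), Rem. 1.21 (p. 8), §1.5 (1), §2 (pp. 11–12)] [cite: Washington1997, §5.1 and Thm. 4.2] [cite: SilvermanAEC2009, IV.6.4 and VII.6.3] -/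
theorem not_isOfFinAddOrder_heegnerPoint_twist_cm7_even_of_thm120 {n r : ℕ} [hn : NeZero n] [hr : Fact r.Prime]
    (hn4 : n % 4 = 1 ∨ n % 4 = 2) (hsq : Squarefree n) (h7n : ¬ 7 ∣ n)
    (hr8 : r % 8 = 7) (hr7 : r ≠ 7) (hrn : r.Coprime n)
    (h7split : legendreSym 7 (-(r : ℤ)) = 1)
    (hsplit : ∀ q : ℕ, q.Prime → q ∣ n → q ≠ 2 → J(-(r : ℤ) | q) = 1)
    (hcert₁ : ∀ (ω : DirichletCharacter ℚ_[7] 7), IsTeichmullerCharacter ω →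
      ∀ θ : DirichletCharacter ℚ_[7] (7 * (4 * n)),
        (∀ j : ZMod (7 * (4 * n)), θ j =
          ((if Even j.val then (0 : ℤ) else J(-(n : ℤ) | j.val) : ℤ) : ℚ_[7]) * ω (j.val : ZMod 7) ^ 4) →
        ‖generalizedBernoulli 1 θ‖ = 1)
    (hcert₂ : ∀ (ω : DirichletCharacter ℚ_[7] 7), IsTeichmullerCharacter ω →
      ∀ θ : DirichletCharacter ℚ_[7] (7 * (4 * n) * r),
        (∀ j : ZMod (7 * (4 * n) * r), θ j =
          (((if Even j.val then (0 : ℤ) else J(-(n : ℤ) | j.val)) * J((j.val : ℤ) | r) : ℤ) : ℚ_[7]) *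
            ω (j.val : ZMod 7) ^ 1) →
        ‖generalizedBernoulli 1 θ‖ = 1)
    (h120 : KrizLi2019.thm120_padicLogHeegner_unit_of_bernoulli)
    (W : WeierstrassCurve ℚ) [W.IsElliptic] [W.IsGloballyMinimal]
    (hW : ∃ C : VariableChange ℚ, C • W = cm7.quadraticTwist ((-(4 * (n : ℤ)) : ℤ) : ℚ))
    (K : Type) [Field K] [NumberField K] (hK : IsImaginaryQuadratic K) (hdK : NumberField.discr K = -(r : ℤ))
    {P : (W.baseChange K).toAffine.Point}
    (hP : haveI : NeZero (W.conductorNorm ℤ) := ⟨(W.conductorNorm_pos_holds).ne'⟩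
      IsHeegnerPoint (W.conductorNorm ℤ) W K P) :
    ¬ IsOfFinAddOrder P := by
  haveI : Fact (Nat.Prime 7) := ⟨by norm_num⟩
  haveI iN : NeZero (W.conductorNorm ℤ) := ⟨(W.conductorNorm_pos_holds).ne'⟩
  -- arithmetic of the parameters
  have hr4 : r % 4 = 3 := by omega
  have hr2 : r ≠ 2 := by rintro rfl; norm_num at hr4
  have hr7' : r.Coprime 7 := (Nat.coprime_primes hr.out (by norm_num)).mpr hr7
  have hn7 : (4 * n).Coprime 7 := by
    rw [Nat.coprime_comm, Nat.Prime.coprime_iff_not_dvd (by norm_num)]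
    intro hd
    exact h7n ((Nat.Prime.dvd_mul (by norm_num)).mp hd |>.resolve_left (by norm_num))
  have hrn4 : r.Coprime (4 * n) := Nat.Coprime.mul_right
    (by simpa using Nat.Coprime.pow_right 2 ((Nat.coprime_primes hr.out Nat.prime_two).mpr hr2)) hrn
  have hD0 : (-(4 * (n : ℤ))) ≠ 0 := by have := hn.out; omega
  have hnat : (NumberField.discr K).natAbs = r := by rw [hdK]; simp
  haveI : NeZero (NumberField.discr K).natAbs := ⟨by rw [hnat]; exact hr.out.ne_zero⟩
  -- the datum behind `P`
  obtain ⟨D, H, ι, hPH⟩ := hP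
  -- the characters: `ω` Teichmüller mod 7, `χ = χ_{−4n}` mod `4n` (Kronecker values), `ψ = χ·ω²`, `κ' = (·/r)`
  obtain ⟨ω, hω⟩ := exists_isTeichmullerCharacter (p := 7)
  obtain ⟨χ, hχ⟩ := exists_kroneckerFour (-(n : ℤ)) (by have := hn.out; omega) (k := 4 * n) (by simp)
  have hχodd : ∀ a : ℕ, Odd a → χ (a : ZMod (4 * n)) = (J(-(n : ℤ) | a) : ℚ_[7]) := fun a ha => by
    rw [hχ a, if_neg (Nat.not_even_iff_odd.mpr ha)]
  have hχp : χ.IsPrimitive := isPrimitive_kroneckerFour (m := -(n : ℤ)) (by simp) (by omega)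
    (by rw [← Int.squarefree_natAbs]; simpa using hsq) hχodd
  have hχo : χ.Odd := kroneckerFour_odd (m := -(n : ℤ)) (by simp) (by have := hn.out; omega) (by omega) hχodd
  obtain ⟨κ', hκ'⟩ := exists_legendreCharacter r
  have hκ'J : ∀ a : ℕ, κ' (a : ZMod r) = (jacobiSym (a : ℤ) r : ℚ_[7]) := fun a => by
    rw [hκ', jacobiSym.legendreSym.to_jacobiSym]
  have hκ'p : κ'.IsPrimitive := conductor_eq_of_prime_of_ne_one κ' (legendreChar_ne_one hr2 κ' hκ')
  set ψ : DirichletCharacter ℚ_[7] (7 * (4 * n)) :=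
    changeLevel (dvd_mul_left (4 * n) 7) χ * changeLevel (dvd_mul_right 7 (4 * n)) (ω ^ 2) with hψdef
  -- CM data of `W`
  have hCM : W.HasCM := hasCM_of_twist_cm7 W hD0 hW
  -- the trace hypothesis `a_ℓ(W) ≡ ψ(ℓ) + ψ⁻¹ω(ℓ) (mod 7)`
  have hss : ∀ ℓ : ℕ, ℓ.Prime → ¬ (ℓ ∣ 7 * W.conductorNorm ℤ) →
      ‖((W.LFunction ℓ : ℤ) : ℚ_[7]) -
        (ψ (ℓ : ZMod (7 * (4 * n))) + ψ⁻¹ (ℓ : ZMod (7 * (4 * n))) * ω (ℓ : ZMod 7))‖ < 1 := by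
    refine hss_twist_cm7_even W hn4 hsq h7n hW ψ ω hω fun ℓ hℓ hℓN => ?_
    have h7 : ¬ 7 ∣ ℓ := by
      intro h
      have : ℓ = 7 := ((Nat.prime_dvd_prime_iff_eq (by norm_num) hℓ).mp h).symm
      subst this
      exact hℓN (dvd_mul_right 7 _)
    by_cases hc : ℓ.Coprime (4 * n)
    · rw [hψdef]
      exact psiK_traceIdentity ω χ _ hχ kroneckerVal_trichotomy ℓ h7 hc
    · have hnu : ¬ IsUnit ((ℓ : ℕ) : ZMod (7 * (4 * n))) := by
        rw [ZMod.isUnit_iff_coprime, Nat.coprime_mul_iff_right]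
        exact fun h => hc h.2
      rw [MulChar.map_nonunit _ hnu, MulChar.map_nonunit _ hnu, zero_mul, add_zero,
        quadVal_eq_zero χ _ hχ hc, zero_mul]
  -- the Kronecker character of `K = ℚ(√−r)` and the Bernoulli hypothesis from the two certificates
  have hdiv : r ∣ (NumberField.discr K).natAbs := by rw [hnat]
  set εK := changeLevel hdiv κ' with hεKdef
  have hεK : KrizLi2019.IsKroneckerCharacterOf K εK :=
    isKroneckerCharacterOf_changeLevel_jacobi hK.1 (Or.inr ⟨hdK, hr4⟩) κ' hκ'p hκ'J hdiv
  haveI i1 : NeZero (7 * (4 * n) * (NumberField.discr K).natAbs) := ⟨by rw [hnat]; exact NeZero.ne _⟩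
  haveI i2 : NeZero (7 * (4 * n) * (NumberField.discr K).natAbs * 7) :=
    ⟨by rw [hnat]; exact NeZero.ne _⟩
  have hB : ¬ (‖bernoulliOnePrim (bernoulliCharOne ψ εK) *
      bernoulliOnePrim (bernoulliCharTwo ψ εK ω)‖ ≤ (7 : ℝ)⁻¹) := by
    have e1 : bernoulliOnePrim (bernoulliCharOne ψ εK) = bernoulliOnePrim (bernoulliCharOne ψ κ') := by
      rw [hεKdef, bernoulliCharOne_changeLevel, bernoulliOnePrim_changeLevel]
    have e2 : bernoulliOnePrim (bernoulliCharTwo ψ εK ω) = bernoulliOnePrim (bernoulliCharTwo ψ κ' ω) := by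
      rw [hεKdef, bernoulliCharTwo_changeLevel, bernoulliOnePrim_changeLevel]
    rw [e1, e2]
    exact bernoulli_hypothesis_of_certs (p := 7) ψ⁻¹ (psiJ_inv_isPrimitive ω χ hn7 hω hχp)
      (dvd_mul_right (7 * (4 * n)) r)
      (changeLevel ((dvd_mul_left (4 * n) 7).trans (dvd_mul_right (7 * (4 * n)) r)) χ *
        changeLevel (dvd_mul_left r (7 * (4 * n))) κ' *
        changeLevel ((dvd_mul_right 7 (4 * n)).trans (dvd_mul_right (7 * (4 * n)) r)) ω)
      (thetaTwoJ_isPrimitive ω χ κ' hn7 hr7' hrn4 hω hχp hκ'p) (dvd_mul_right (7 * (4 * n) * r) 7)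
      _ (bernoulliCharOne_psiK ω χ κ' hχo) _ (bernoulliCharTwo_psiK ω χ κ' hχo)
      (hcert₁ ω hω _ (psiK_inv_apply ω χ _ hχ kroneckerVal_trichotomy))
      (hcert₂ ω hω _ (thetaTwoK_apply ω χ _ κ' _ hχ hκ'J))
  -- the Heegner hypothesis for `N(W)`, `7` split, and the embedding `K ↪ ℚ₇` at a degree-one prime over `7`
  obtain ⟨hHN, h7K⟩ := satisfiesHeegnerHypothesis_twist_cm7_even hr8 h7split hsplit W hW K hK hdK
  have h7K' : ((Ideal.span {((7 : ℕ) : ℤ)}).primesOver (𝓞 K)).ncard = 2 := by exact_mod_cast h7K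
  obtain ⟨𝔭, h𝔭, he, hf⟩ := X11b.exists_degreeOnePrime_of_splitsIn K 7 hK.1 h7K'
  -- the bad primes `ℓ ≠ 7` (`ℓ = 2` or `ℓ ∣ n`) are not coprime to the conductor `7·4n` of `ψ`
  have hbadψ : ∀ {ℓ : ℕ}, ℓ.Prime → (ℓ = 2 ∨ ℓ ∣ n) → ¬ ℓ.Coprime (7 * (4 * n)) := by
    intro ℓ hℓ h hc
    have hc' : ℓ.Coprime (4 * n) := Nat.Coprime.coprime_dvd_right (dvd_mul_left _ 7) hc
    rcases h with h | h
    · subst h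
      have := Nat.Coprime.coprime_dvd_right (dvd_mul_right 4 n) hc'
      norm_num at this
    · exact hℓ.one_lt.ne' (Nat.Coprime.eq_one_of_dvd (Nat.Coprime.coprime_dvd_right (dvd_mul_left n 4) hc') h)
  -- Thm. 1.20
  have key := h120 7 (by norm_num) W (7 * (4 * n)) ψ ω (psiJ_isPrimitive ω χ hn7 hω hχp) hω hss
    (psiJ_apply_natCast_ne_one_of_not_coprime ψ (a := 7) (by
      rw [Nat.coprime_mul_iff_right, not_and_or]; exact Or.inl (by norm_num)))
    (primVal_invMulOmega_psiJ_ne_one ω χ hn7 hω hχp (a := 7) (by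
      rw [Nat.coprime_mul_iff_right, not_and_or]; exact Or.inl (by norm_num)))
    (not_hasSplitMultiplicativeReductionAtPrime_of_hasCM W hCM)
    (fun ℓ hℓ h7ℓ hbad => by
      haveI := Fact.mk hℓ
      have h := hbadψ hℓ (eq_two_or_dvd_of_not_hasGoodReductionAtPrime_twist_cm7_even W hW ℓ h7ℓ hbad.1)
      exact ⟨psiJ_apply_natCast_ne_one_of_not_coprime ψ h,
        primVal_invMulOmega_psiJ_ne_one ω χ hn7 hω hχp h⟩)
    D K hK hHN h7K' εK hεK H ι (X11b.embAt K 7 𝔭 h𝔭 he hf) P hPH hB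
  have hlog := padicLogOmega_ne_zero_of_not_norm_le key
  exact fun hfin => hlog ((X11b.R1.logOmega_eq_zero_iff W 7 (X11b.embAt K 7 𝔭 h𝔭 he hf) P).mpr hfin)


/-! ## §2 B/C — Gross–Zagier: `ord L(W/K) = 1`, `r_an(W) + r_an(W^{(−r)}) = 1`, and `r_an(W) = 1` from oddness -/

section RankOne

variable {n r : ℕ} [hn : NeZero n] [hr : Fact r.Prime]
  (hn4 : n % 4 = 1 ∨ n % 4 = 2) (hsq : Squarefree n) (h7n : ¬ 7 ∣ n)
  (hr8 : r % 8 = 7) (hr7 : r ≠ 7) (hrn : r.Coprime n)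
  (h7split : legendreSym 7 (-(r : ℤ)) = 1)
  (hsplit : ∀ q : ℕ, q.Prime → q ∣ n → q ≠ 2 → J(-(r : ℤ) | q) = 1)
  (hcert₁ : ∀ (ω : DirichletCharacter ℚ_[7] 7), IsTeichmullerCharacter ω →
    ∀ θ : DirichletCharacter ℚ_[7] (7 * (4 * n)),
      (∀ j : ZMod (7 * (4 * n)), θ j =
        ((if Even j.val then (0 : ℤ) else J(-(n : ℤ) | j.val) : ℤ) : ℚ_[7]) * ω (j.val : ZMod 7) ^ 4) →
      ‖generalizedBernoulli 1 θ‖ = 1)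
  (hcert₂ : ∀ (ω : DirichletCharacter ℚ_[7] 7), IsTeichmullerCharacter ω →
    ∀ θ : DirichletCharacter ℚ_[7] (7 * (4 * n) * r),
      (∀ j : ZMod (7 * (4 * n) * r), θ j =
        (((if Even j.val then (0 : ℤ) else J(-(n : ℤ) | j.val)) * J((j.val : ℤ) | r) : ℤ) : ℚ_[7]) *
          ω (j.val : ZMod 7) ^ 1) →
      ‖generalizedBernoulli 1 θ‖ = 1)
  (h120 : KrizLi2019.thm120_padicLogHeegner_unit_of_bernoulli)
  (hnf : exists_isNewformOf)
  (hGZ : ∀ (N : ℕ) [NeZero N] (V : WeierstrassCurve ℚ) (L : Type) [Field L] [NumberField L], gross_zagier N V L)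
  (hHP : ∀ (V : WeierstrassCurve ℚ) (L : Type) [Field L] [NumberField L], exists_isHeegnerPoint V L)

include hn4 hsq h7n hr8 hr7 hrn h7split hsplit hcert₁ hcert₂ h120 hnf hGZ hHP

/-- **B (over `K`). `ord_{s=1} L(W/ℚ(√−r), s) = 1` for every globally minimal `W ≅ 49a1^{(−4n)}` on the double-unit locus**,
granted KL19 Thm. 1.20 (`h120`), Modularity (`hnf`: the sign / `L(W/K,1) = 0`), Gross–Zagier (`hGZ`) and Heegner
rationality (`hHP`): a level-`N(W)` Heegner point exists (§0 Heegner hypothesis), §1 puts it off the torsion, and the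
dictionary `analyticRankEK_eq_one_iff_heegner_nonTorsion_of_exists_isNewformOf` converts.
[cite: GrossZagier1986, Thm. I.(6.3) with V.§2 and I.§7] [cite: KrizLi2019, Thm. 1.20 (pp. 7–8)] -/
theorem analyticRankEK_twist_cm7_even_eq_one_of_thm120
    (W : WeierstrassCurve ℚ) [W.IsElliptic] [W.IsGloballyMinimal]
    (hW : ∃ C : VariableChange ℚ, C • W = cm7.quadraticTwist ((-(4 * (n : ℤ)) : ℤ) : ℚ))
    (K : Type) [Field K] [NumberField K] (hK : IsImaginaryQuadratic K) (hdK : NumberField.discr K = -(r : ℤ)) :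
    analyticRankEK W K = 1 := by
  haveI iN : NeZero (W.conductorNorm ℤ) := ⟨(W.conductorNorm_pos_holds).ne'⟩
  obtain ⟨hHN, -⟩ := satisfiesHeegnerHypothesis_twist_cm7_even hr8 h7split hsplit W hW K hK hdK
  obtain ⟨P, hP⟩ := hHP W K hK hHN
  exact (analyticRankEK_eq_one_iff_heegner_nonTorsion_of_exists_isNewformOf W (W.conductorNorm ℤ) K
    (hGZ _ W K) hnf hK rfl hHN hP).mpr
    (not_isOfFinAddOrder_heegnerPoint_twist_cm7_even_of_thm120 hn4 hsq h7n hr8 hr7 hrn h7split hsplit hcert₁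
      hcert₂ h120 W hW K hK hdK hP)

/-- **B (over `ℚ`). `r_an(W) + r_an(W^{(−r)}) = 1`** (Artin formalism `ord L(W/K) = ord L(W) + ord L(W^{(d_K)})`,
`analyticRankEK_eq_add_of`, modularity), for `W`, `K = ℚ(√−r)` as in B. [cite: GrossZagier1986, I.§7] -/
theorem analyticRank_add_twist_eq_one_twist_cm7_even_of_thm120
    (W : WeierstrassCurve ℚ) [W.IsElliptic] [W.IsGloballyMinimal]
    (hW : ∃ C : VariableChange ℚ, C • W = cm7.quadraticTwist ((-(4 * (n : ℤ)) : ℤ) : ℚ))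
    (K : Type) [Field K] [NumberField K] (hK : IsImaginaryQuadratic K) (hdK : NumberField.discr K = -(r : ℤ)) :
    W.analyticRank + (W.quadraticTwist (NumberField.discr K : ℚ)).analyticRank = 1 := by
  rw [← analyticRankEK_eq_add_of (hasEntireLFunction_rat_of_exists_isNewformOf hnf) W K]
  exact analyticRankEK_twist_cm7_even_eq_one_of_thm120 hn4 hsq h7n hr8 hr7 hrn h7split hsplit hcert₁ hcert₂
    h120 hnf hGZ hHP W hW K hK hdK

/-- **`r_an(W) ≤ 1`** for every globally minimal `W ≅ 49a1^{(−4n)}` on the double-unit locus (B over `ℚ` at the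
auxiliary field `ℚ(√−r)`, which exists: `Quadratic.exists_numberField_discr_eq` at the fundamental discriminant
`−r ≡ 1 (mod 4)`). [cite: GrossZagier1986, I.§7] [cite: Cox2013, §1.C (fundamental discriminants)] -/
theorem analyticRank_le_one_twist_cm7_even_of_thm120
    (W : WeierstrassCurve ℚ) [W.IsElliptic] [W.IsGloballyMinimal]
    (hW : ∃ C : VariableChange ℚ, C • W = cm7.quadraticTwist ((-(4 * (n : ℤ)) : ℤ) : ℚ)) :
    W.analyticRank ≤ 1 := by
  have hr4 : r % 4 = 3 := by omega
  obtain ⟨K, _, _, hK2, hdK⟩ := Quadratic.exists_numberField_discr_eq (D := -(r : ℤ))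
    (Or.inl ⟨by omega, by rw [← Int.squarefree_natAbs]; simpa using hr.out.squarefree, by omega⟩)
  have hK : IsImaginaryQuadratic K :=
    ⟨hK2, Quadratic.isTotallyComplex_of_discr_neg hK2 (by rw [hdK, neg_lt_zero]; exact_mod_cast hr.out.pos)⟩
  have h := analyticRank_add_twist_eq_one_twist_cm7_even_of_thm120 hn4 hsq h7n hr8 hr7 hrn h7split hsplit hcert₁
    hcert₂ h120 hnf hGZ hHP W hW K hK hdK
  omega

/-- **C. `r_an(W) = 1` for every globally minimal `W ≅ 49a1^{(−4n)}` on the double-unit locus whose analytic rank is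
ODD** — the oddness is supplied by the crux's hypothesis (`corank₂ = 1`, next theorem) or, unconditionally, by the
sign law `w(49a1^{(−n)}) = −1` of the cone file `…TwinAdditiveSign` (sequel). [cite: GrossZagier1986, I.§7] -/
theorem analyticRank_eq_one_twist_cm7_even_of_thm120_of_odd
    (W : WeierstrassCurve ℚ) [W.IsElliptic] [W.IsGloballyMinimal]
    (hW : ∃ C : VariableChange ℚ, C • W = cm7.quadraticTwist ((-(4 * (n : ℤ)) : ℤ) : ℚ))
    (hodd : Odd W.analyticRank) : W.analyticRank = 1 := by
  have h := analyticRank_le_one_twist_cm7_even_of_thm120 hn4 hsq h7n hr8 hr7 hrn h7split hsplit hcert₁ hcert₂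
    h120 hnf hGZ hHP W hW
  obtain ⟨k, hk⟩ := hodd
  omega

/-- **C′. K12₂″'s implication OUTRIGHT on the double-unit locus: `corank_{ℤ₂} Sel_{2^∞}(W/ℚ) = 1 ⟹ r_an(W) = 1`**
for every globally minimal `W ≅ 49a1^{(−4n)}` (BOTH halves), granted in addition the `2`-parity fact
(`p_parity · 2`, Dokchitser–Dokchitser: `(−1)^{corank₂} = w(W)`, so `w(W) = −1` and `r_an` is odd by the functional
equation, `odd_analyticRank_of_rootNumber_eq_neg_one`). This is the registered crux's statement restricted to these
`W`, with its conclusion proved. [cite: DokchitserDokchitserAnnals2010, Thm. 1.4] [cite: KrizLi2019, Thm. 1.20 (pp. 7–8)] -/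
theorem rankOneTwoConverse_twist_cm7_even_of_thm120
    (hpar : ∀ (V : WeierstrassCurve ℚ) [V.IsElliptic], p_parity V 2)
    (W : WeierstrassCurve ℚ) [W.IsElliptic] [W.IsGloballyMinimal]
    (hW : ∃ C : VariableChange ℚ, C • W = cm7.quadraticTwist ((-(4 * (n : ℤ)) : ℤ) : ℚ))
    (hco : W.selmerCorank 2 = 1) : W.analyticRank = 1 := by
  refine analyticRank_eq_one_twist_cm7_even_of_thm120_of_odd hn4 hsq h7n hr8 hr7 hrn h7split hsplit hcert₁
    hcert₂ h120 hnf hGZ hHP W hW (odd_analyticRank_of_rootNumber_eq_neg_one ?_)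
  have h : (-1 : ℤ) ^ W.selmerCorank 2 = W.rootNumber := hpar W
  rw [hco, pow_one] at h
  exact h.symm

/-- **C″ (model-free). `r_an(W′) = 1` for EVERY elliptic `W′/ℚ` that is `ℚ`-isomorphic to `49a1^{(−n)}` and has
`corank_{ℤ₂} Sel_{2^∞} = 1`-parity witnessed by an odd analytic rank**, on the double-unit locus: `49a1^{(−4n)} ≅
49a1^{(−n)}` (`quadraticTwist_sq_mul`), a globally minimal model of `W′` exists
(`hasGlobalMinimalModel_rat_holds`), and `r_an` is a `ℚ`-isomorphism invariant (`analyticRank_smul`).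
[cite: SilvermanAEC2009, X.5 Prop. 5.4, VIII.8 and App. C §16] -/
theorem analyticRank_eq_one_of_smul_eq_twist_cm7_neg_of_thm120_of_odd
    (W' : WeierstrassCurve ℚ) [W'.IsElliptic] (C' : VariableChange ℚ)
    (hW' : C' • W' = cm7.quadraticTwist ((-(n : ℤ) : ℤ) : ℚ)) (hodd : Odd W'.analyticRank) :
    W'.analyticRank = 1 := by
  obtain ⟨Cm, hmin⟩ := hasGlobalMinimalModel_rat_holds W'
  haveI := hmin
  have h4 : cm7.quadraticTwist ((-(4 * (n : ℤ)) : ℤ) : ℚ) =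
      (⟨(Units.mk0 (2 : ℚ) two_ne_zero)⁻¹, 0, 0, 0⟩ : VariableChange ℚ) • cm7.quadraticTwist ((-(n : ℤ) : ℤ) : ℚ) := by
    rw [show ((-(4 * (n : ℤ)) : ℤ) : ℚ) = (2 : ℚ) ^ 2 * (((-(n : ℤ)) : ℤ) : ℚ) by push_cast; ring]
    exact cm7.quadraticTwist_sq_mul two_ne_zero _
  have hWm : ∃ C : VariableChange ℚ, C • (Cm • W') = cm7.quadraticTwist ((-(4 * (n : ℤ)) : ℤ) : ℚ) := by
    refine ⟨(⟨(Units.mk0 (2 : ℚ) two_ne_zero)⁻¹, 0, 0, 0⟩ : VariableChange ℚ) * C' * Cm⁻¹, ?_⟩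
    rw [mul_smul, mul_smul, inv_smul_smul, hW', h4]
  have hr' : (Cm • W').analyticRank = W'.analyticRank := WeierstrassCurve.analyticRank_smul W' Cm
  rw [← hr']
  exact analyticRank_eq_one_twist_cm7_even_of_thm120_of_odd hn4 hsq h7n hr8 hr7 hrn h7split hsplit hcert₁ hcert₂
    h120 hnf hGZ hHP (Cm • W') hWm (hr' ▸ hodd)

end RankOne


end Summit.BirchSwinnertonDyer.BirchSwinnertonDyer.Theorems.GoldfeldGoodTwists

end
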